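import Literature.Computability.AlgebraicComplexity.CohnUmansTPPProofs
import Literature.Computability.AlgebraicComplexity.TPPGroupExtension
import HarnessLib

/-!
# Cohn–Umans 2003, Cor. 4.2: "if `α(G) < γ(G)` then `ω ≤ α(γ−2)/(γ−α)`" — the race between `α` and `γ`

Topic `Literature/Computability/AlgebraicComplexity` (group-theoretic matrix multiplication), namespace
`Literature.Computability.AlgebraicComplexity`; a corollary of CU Thm. 4.1 = CKSU Thm. 1.8 / Cor. 1.9, which the
tree has DISCHARGED (`CKSU2005_thm18_holds`, `CKSU2005_cor19_holds`, `CohnUmansTPPProofs.lean`).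

H. Cohn, C. Umans, *A group-theoretic approach to fast matrix multiplication*, FOCS 2003 = arXiv:math/0307321, §4
(p. 6 of the held text `paper:arxiv-math_0307321`): "We define `γ(G)` … so that `|G|^{1/γ}` is the maximum character
degree of `G` (`γ(G) = ∞` if `G` is abelian) … **Corollary 4.2** (Corollary 8 of the arXiv text). Let `G` be a finite
group. If `α(G) < γ(G)`, then `ω ≤ α((γ − 2)/(γ − α))`. *Proof.* Let `{dᵢ}` denote the character degrees. Then by
Theorem 4.1, `|G|^{ω/α} ≤ Σᵢ dᵢ^{ω−2}dᵢ² ≤ |G|^{(ω−2)/γ} Σᵢ dᵢ² = |G|^{1+(ω−2)/γ}`, which implies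
`ω(1/α − 1/γ) ≤ 1 − 2/γ`. Dividing by `1/α − 1/γ` (which is positive by assumption) yields the stated result."
"… our approach amounts to a race between `α(G)` and `γ(G)` to see which approaches `2` faster."

## Lean form (no `α`, `γ` definitions in the tree; the statement is per realized triple and per degree bound)
For `G` realizing `⟨n,m,p⟩` and any `d ≥ max character degree` (this is all `γ` is used for: "they only require
knowledge of `γ(G)`"), with `N = nmp`, `L = log|G|`: the condition `α < γ` for this data reads `d³ < N`, and the
conclusion `α(γ−2)/(γ−α)` with `α = 3L/log N`, `γ = L/log d` simplifies to
**`ω ≤ 3(log|G| − 2 log d)/(log N − 3 log d)`** (`CohnUmans2003_cor42`); `CohnUmans2003_cor42_alpha_gamma` restates it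
in the printed shape `ω ≤ α(γ−2)/(γ−α)` for `d ≥ 2`. (Example: CKSU §2, `d = 2`, `|G| = 2·17⁶`, `N = (2·17·16)³`
gives `2.9088`, the tree's `CohnKleinbergSzegedyUmans2005_sec2`.) Cor. 4.3 (families with `α − 2 = o(γ − 2)` give
`ω = 2`) is an asymptotic reading of the same inequality and is not restated.

## References
* H. Cohn, C. Umans, FOCS 2003, 438–449; arXiv:math/0307321, §4, Cor. 4.2 (Cor. 8 of the arXiv text, p. 6) and the
  definition of `γ` before it. [CohnUmans2003]
-/

noncomputable section

namespace Literature.Computability.AlgebraicComplexity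

open Literature.RepresentationTheory.FiniteGroups

variable {G : Type} [Group G] [Finite G]

/-- **Cohn–Umans 2003, Cor. 4.2, explicit form**: if `G` realizes `⟨n, m, p⟩`, every character degree of `G` is
`≤ d` (`d ≥ 1`) and `d³ < nmp` (i.e. `α < γ` for this data), then
`ω ≤ 3 (log|G| − 2 log d) / (log(nmp) − 3 log d)` — from Cor. 1.9 `(nmp)^{ω/3} ≤ d^{ω−2}|G|` by taking logarithms:
"`|G|^{ω/α} ≤ Σ dᵢ^{ω−2}dᵢ² ≤ |G|^{(ω−2)/γ}|G|` … `ω(1/α − 1/γ) ≤ 1 − 2/γ`".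
[cite: CohnUmans2003, Cor. 4.2 (Cor. 8 of the arXiv text, p. 6)] -/
theorem CohnUmans2003_cor42 {n m p d : ℕ} (h : RealizesTPP G n m p) (hd : maxCharDegree G ≤ d)
    (hd1 : 1 ≤ d) (hlt : d ^ 3 < n * m * p) :
    omega ℂ ≤ 3 * (Real.log (Nat.card G) - 2 * Real.log d) /
      (Real.log ((n * m * p : ℕ) : ℝ) - 3 * Real.log d) := by
  have key := CKSU2005_cor19_holds.rpow_le_of_maxCharDegree_le h hd
  have hNpos : (0 : ℝ) < ((n * m * p : ℕ) : ℝ) := by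
    have : 0 < n * m * p := lt_of_le_of_lt (Nat.zero_le _) hlt
    exact_mod_cast this
  have hdpos : (0 : ℝ) < d := by exact_mod_cast hd1
  have hGpos : (0 : ℝ) < Nat.card G := by exact_mod_cast Nat.card_pos
  -- logarithms of Cor. 1.9
  have hlog := Real.log_le_log (Real.rpow_pos_of_pos hNpos _) key
  rw [Real.log_rpow hNpos, Real.log_mul (Real.rpow_pos_of_pos hdpos _).ne' hGpos.ne',
    Real.log_rpow hdpos] at hlog
  -- `3 log d < log N`
  have hden : 3 * Real.log d < Real.log ((n * m * p : ℕ) : ℝ) := by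
    have h3 : ((d : ℝ)) ^ 3 < ((n * m * p : ℕ) : ℝ) := by exact_mod_cast hlt
    have := Real.log_lt_log (by positivity) h3
    rwa [Real.log_pow] at this
  rw [le_div_iff₀ (by linarith)]
  nlinarith [hlog]

/-- A group realizing `⟨n,m,p⟩` with `nmp ≥ 2` is non-trivial (`nm, mp, pn ≤ |G|`).
[cite: CohnUmans2003, Lemma 3.1 (proof)] -/
theorem RealizesTPP.one_lt_card {n m p : ℕ} (h : RealizesTPP G n m p) (h2 : 2 ≤ n * m * p) :
    1 < Nat.card G := by
  haveI := Fintype.ofFinite G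
  rw [Nat.card_eq_fintype_card]
  have hn : n ≠ 0 := fun h0 => by simp [h0] at h2
  have hm : m ≠ 0 := fun h0 => by simp [h0] at h2
  have hp : p ≠ 0 := fun h0 => by simp [h0] at h2
  have h12 := h.mul_le_card hp
  have h23 := h.rotate.mul_le_card hn
  by_contra hG
  have hG1 : Fintype.card G ≤ 1 := by omega
  have hnm : n * m ≤ 1 := h12.trans hG1
  have hp1 : p ≤ 1 := (Nat.le_mul_of_pos_left p (Nat.pos_of_ne_zero hm)).trans (h23.trans hG1)
  have : n * m * p ≤ 1 * 1 := Nat.mul_le_mul hnm hp1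
  omega

/-- **Cohn–Umans 2003, Cor. 4.2 in the printed shape `ω ≤ α(γ−2)/(γ−α)`**, for the pseudo-exponent-type value
`α = 3 log|G| / log(nmp)` of a realized triple and `γ = log|G| / log d` for a degree bound `d ≥ 2` (so
`|G|^{1/γ} = d`); the hypothesis `α < γ` is `d³ < nmp`. [cite: CohnUmans2003, Cor. 4.2 (Cor. 8 of the arXiv text, p. 6)] -/
theorem CohnUmans2003_cor42_alpha_gamma {n m p d : ℕ} (h : RealizesTPP G n m p) (hd : maxCharDegree G ≤ d)
    (hd2 : 2 ≤ d) (hlt : d ^ 3 < n * m * p) {α γ : ℝ}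
    (hα : α = 3 * Real.log (Nat.card G) / Real.log ((n * m * p : ℕ) : ℝ))
    (hγ : γ = Real.log (Nat.card G) / Real.log d) :
    α < γ ∧ omega ℂ ≤ α * ((γ - 2) / (γ - α)) := by
  have hmain := CohnUmans2003_cor42 h hd (by omega) hlt
  have hN2 : 2 ≤ n * m * p := (hd2.trans (Nat.le_self_pow three_ne_zero d)).trans hlt.le
  have hG := h.one_lt_card hN2
  have hL : 0 < Real.log (Nat.card G) := Real.log_pos (by exact_mod_cast hG)
  have hℓd : 0 < Real.log d := Real.log_pos (by exact_mod_cast hd2)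
  have hℓN : 3 * Real.log d < Real.log ((n * m * p : ℕ) : ℝ) := by
    have h3 : ((d : ℝ)) ^ 3 < ((n * m * p : ℕ) : ℝ) := by exact_mod_cast hlt
    have := Real.log_lt_log (by positivity) h3
    rwa [Real.log_pow] at this
  have hℓN0 : 0 < Real.log ((n * m * p : ℕ) : ℝ) := by linarith
  set L := Real.log (Nat.card G) with hLdef
  set ℓN := Real.log ((n * m * p : ℕ) : ℝ) with hℓNdef
  set ℓd := Real.log (d : ℝ) with hℓddef
  have hαγ : α < γ := by
    rw [hα, hγ, div_lt_div_iff₀ hℓN0 hℓd]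
    nlinarith
  refine ⟨hαγ, ?_⟩
  have e : α * ((γ - 2) / (γ - α)) = 3 * (L - 2 * ℓd) / (ℓN - 3 * ℓd) := by
    have hγα : γ - α = L * (ℓN - 3 * ℓd) / (ℓd * ℓN) := by
      rw [hα, hγ]; field_simp
    have hγ2 : γ - 2 = (L - 2 * ℓd) / ℓd := by
      rw [hγ]; field_simp
    rw [hγα, hγ2, hα]
    field_simp
  rw [e]
  exact hmain

end Literature.Computability.AlgebraicComplexity

end
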